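import Summits.QuantumFields.YangMills.Theorems.UnitScaleTiltFluctuationComparisonRegPrGlobalSlackStepFarTheta
import Summits.QuantumFields.YangMills.Theorems.UnitScaleTiltFluctuationComparisonRegPrGlobalSlackKernelLegBirth
import HarnessLib

/-!
# `UnitScaleTiltFluctuationComparisonRegPrGlobalSlackStepFarBirth` — THE STEP RECORD'S FAR PART OF THE CANONICAL BIRTH REST ON THE LISTED NEW-LEVEL DOMAINS, IN THE RESIDUAL ROW'S
# CURRENCY WITH THE CANONICAL TREE LENGTH (crux `FluctuationComparisonRegPrIntL`, stmt-QuantumFields-20520, pen v5kC stub 3⁗χ; width seat ym-ust-20520-w3 g0, (R3)-birth assist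
# for ★ym-ust-20520-w1 g0; YM₃ on the 3-torus is ladder rung R3, not the Clay problem)

WHY.  ★w1 g0's `GlobalSlackKernelLeg.canonPTCore_birth_eq'` (p585084) writes the canonical newborn term of a listed new-level point set `Y` as the jet of the birth chart minus
`birthFarAt q K b Y W = Σ_{X ∈ birthDoms q K b Y} (far_X + far^Λ_X)` — the rest of the structure row at the birth level.  The own-indexed residual row
`GlobalSlackKernelLeg.RemainderSmallOwnΦ` asks that rest to be `≤ C_R·e^{−κ𝓛_K(1+b, Y)}·θ(n)⁷` at the birth reading (`n = K − b − 1`, `x = 1`).  This file puts the 𝔖-PART of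
`birthFarAt` in exactly that currency, from the displayed far row alone (`abs_stepFar_le_theta7`, p585502), with the CANONICAL tree length of the datum
(`canonTreeLenCore_domSet`): **`abs_sum_birthDoms_stepFar_le_of_mem_loc`** — for `b + 1 ≤ K`, every `Y ∈ Loc K (b+1) triv (b+1)` and every `W`,
`|Σ_{X ∈ birthDoms q K b Y} far_X(triv, W)| ≤ C(𝔠, L)·e^{−𝔠.κ·𝓛_K(b+1, Y)}·θBal F.L γ b₀ p₀ (K − b − 1)⁷` (and the retained-domain form `abs_sum_birthDoms_stepFar_le`).
The Λ-part `Σ far^Λ_X` is LOCATED (g-free amplitude `C63`, ★w1 g0 memo §3) and not touched.  Def-free bookkeeping; nothing of [Balaban1985UV3] is asserted; registry untouched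
(`--supports stmt-QuantumFields-20520`); no claim about the crux, d = 4 or the mass gap.

References: T. Bałaban, CMP 102 (1985) 255–275 [Balaban1985UV3] ((24)–(25) p.262, p.264 L14–20, (43) p.266, (57) p.270, (59) p.270).
-/

set_option autoImplicit false

noncomputable section

namespace Summit.QuantumFields.YangMills.Theorems.GlobalSlackCanonicalPolymers

open scoped BigOperators
open Finset
open Literature.MathematicalPhysics.QuantumFieldTheory.Balaban1983to89
open Literature.MathematicalPhysics.QuantumFieldTheory.Balaban1983to89.T3ContinuumYM3Torus
open Literature.MathematicalPhysics.QuantumFieldTheory.Balaban1983to89.T3UnitScaleTilt (θBal)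
open Literature.MathematicalPhysics.QuantumFieldTheory.Balaban1983to89.T3AlphaInputsAC
open Literature.MathematicalPhysics.QuantumFieldTheory.Balaban1983to89.TreeLengthTorus (tsys)
open Literature.MathematicalPhysics.QuantumFieldTheory.Balaban1985CMP102
open Literature.MathematicalPhysics.QuantumFieldTheory.Balaban1985CMP102.Setting
open Summit.QuantumFields.Balaban3D.Carriers
open Summit.QuantumFields.Balaban3D.Proofs.Primitives
open Summit.QuantumFields.Balaban3D.Proofs.NewbornJet (tlConst)
open Summit.QuantumFields.YangMills.Theorems
open Summit.QuantumFields.YangMills.Theorems.GlobalSlackKernelLeg (birthDoms birthDoms_domSet)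

variable {F : T3Family} {𝔠 : AlphaConsts F.L (suGroupModel 2).N} {γ : ℝ} {hγ : 0 < γ} {hγ1 : γ ≤ (min 𝔠.gamma0 1) ^ 2}

variable (q : ∀ K, AlphaInputsT3AC.PkgCoreV3 F 𝔠 γ hγ hγ1 K)

/-- **THE STEP RECORD'S FAR PART OF THE BIRTH REST AT A RETAINED DOMAIN'S POINT SET**: for `b + 1 ≤ K`, a retained step-`b` domain `X` and every `W`,
`|Σ_{X' ∈ birthDoms q K b (domSet X)} far_{X'}(triv, W)| ≤ C(𝔠, L)·θBal(K − b − 1)⁷·e^{−κ·dj X}` — `birthDoms = {X}` and `abs_stepFar_le_theta7`.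
[cite: Balaban1985UV3, p.264 L14-20, (59) p.270, (57) p.270] -/
theorem abs_sum_birthDoms_stepFar_le (K b : ℕ) (hb : b + 1 ≤ K) (X : (tsys 3 (nblkOf (SK F 𝔠 γ hγ hγ1 K) 𝔠.lane.carrier b)).Dom)
    (hX : X ∈ newDomsCore q K b (Hist.triv (F.P K) (b + 1))) (W : GaugeField (F.P K) (b + 1) (Matrix.specialUnitaryGroup (Fin 2) ℂ)) :
    |∑ X' ∈ birthDoms q K b (domSet (F := F) 𝔠.lane.carrier.M₁ K b X), ((q K).𝔖 b).far X' (Hist.triv (F.P K) (b + 1)) W| ≤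
      (𝔠.Cfar * 𝔠.C25 * tlConst (7 * 𝔠.r₀) 1 * ((Real.sqrt F.L)⁻¹ * (1 + Real.log (Real.sqrt F.L)) ^ 𝔠.p₀) ^ 7) *
        θBal F.L γ 𝔠.b₀ 𝔠.p₀ (K - b - 1) ^ 7 * Real.exp (-(𝔠.κ * (tsys 3 (nblkOf (SK F 𝔠 γ hγ hγ1 K) 𝔠.lane.carrier b)).dj X)) := by
  have hbm : b ≤ F.m + K := by have := F.hm; omega
  rw [birthDoms_domSet q K b hbm X hX, sum_singleton]
  exact abs_stepFar_le_theta7 q K b hb X (Hist.triv (F.P K) (b + 1)) W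

/-- **THE STEP RECORD'S FAR PART OF THE BIRTH REST ON THE LISTED NEW-LEVEL DOMAINS, RESIDUAL-ROW CURRENCY**: for `b + 1 ≤ K`, every listed point set `Y` of term level `b+1` at
lattice level `b+1` of run `K` (`Y ∈ Loc K (b+1) triv (b+1)` of the datum `dataOfCoreV3 q (canonPolymerCore q)`) and every `W`,
`|Σ_{X ∈ birthDoms q K b Y} far_X(triv, W)| ≤ C(𝔠, L)·e^{−𝔠.κ·𝓛_K(b+1, Y)}·θBal F.L γ b₀ p₀ (K − b − 1)⁷` with the CANONICAL tree length — the 𝔖-part of ★w1 g0's birth rest in the shape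
of `RemainderSmallOwnΦ`'s clause at the birth reading (`n = K − b − 1`, `j = b`, level factor `x = 1`).  The Λ-part is located, not derived. [cite: Balaban1985UV3, (24)-(25) p.262, p.264 L14-20, (43) p.266, (57) p.270] -/
theorem abs_sum_birthDoms_stepFar_le_of_mem_loc (K b : ℕ) (hb : b + 1 ≤ K) (Y : Set (Site (F.P K) 0))
    (hY : Y ∈ (AlphaInputsT3AC.dataOfCoreV3 q (canonPolymerCore q)).Loc K (b + 1)
      ((AlphaInputsT3AC.dataOfCoreV3 q (canonPolymerCore q)).triv K (b + 1)) (b + 1))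
    (W : GaugeField (F.P K) (b + 1) (Matrix.specialUnitaryGroup (Fin 2) ℂ)) :
    |∑ X ∈ birthDoms q K b Y, ((q K).𝔖 b).far X (Hist.triv (F.P K) (b + 1)) W| ≤
      (𝔠.Cfar * 𝔠.C25 * tlConst (7 * 𝔠.r₀) 1 * ((Real.sqrt F.L)⁻¹ * (1 + Real.log (Real.sqrt F.L)) ^ 𝔠.p₀) ^ 7) *
        Real.exp (-(𝔠.κ * (AlphaInputsT3AC.dataOfCoreV3 q (canonPolymerCore q)).treeLen K (b + 1) Y)) *
          θBal F.L γ 𝔠.b₀ 𝔠.p₀ (K - b - 1) ^ 7 := by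
  classical
  have hbm : b ≤ F.m + K := by have := F.hm; omega
  change Y ∈ canonLocCore q K (b + 1) (Hist.triv (F.P K) (b + 1)) (b + 1) at hY
  simp only [canonLocCore, if_pos hb, ite_true, mem_image] at hY
  obtain ⟨X, hX, rfl⟩ := hY
  change |∑ X' ∈ birthDoms q K b (domSet (F := F) 𝔠.lane.carrier.M₁ K b X), ((q K).𝔖 b).far X' (Hist.triv (F.P K) (b + 1)) W| ≤
    (𝔠.Cfar * 𝔠.C25 * tlConst (7 * 𝔠.r₀) 1 * ((Real.sqrt F.L)⁻¹ * (1 + Real.log (Real.sqrt F.L)) ^ 𝔠.p₀) ^ 7) *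
      Real.exp (-(𝔠.κ * canonTreeLenCore q K (b + 1) (domSet (F := F) 𝔠.lane.carrier.M₁ K b X))) * θBal F.L γ 𝔠.b₀ 𝔠.p₀ (K - b - 1) ^ 7
  rw [canonTreeLenCore_domSet q K b hbm X, mul_right_comm]
  exact abs_sum_birthDoms_stepFar_le q K b hb X hX W

end Summit.QuantumFields.YangMills.Theorems.GlobalSlackCanonicalPolymers

end
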